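import Summits.KontsevichZagierPeriods.KontsevichZagierPeriods.Theorems.SoloInformedPresRatTwo
import Summits.KontsevichZagierPeriods.KontsevichZagierPeriods.Theorems.SoloInformedPresRatLadderOne
import HarnessLib

/-!
# The presentability ladder after PRES-RAT(2)

Solo programme `solo-KontsevichZagierPeriods-informed`, session s111.  Consequences of THEOREM
PRES-RAT(2) (`soloInformed_presRat_two`) on the ladder of file `SoloInformedPresRat`:

* **PRES(1)** (`soloInformed_presAll_one`): *every* absolutely convergent one-dimensional integral
  representation — an arbitrary `ℚ`-semialgebraic (i.e. real algebraic) integrand over a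
  `ℚ`-semialgebraic subset of `ℝ` — is presentable, by the volume-under-the-graph move to a
  rational representation of dimension `2`; equivalently **CUBE(1)**.
* **KZP for all representations of dimension `≤ 1` and rational ones of dimension `≤ 2`**
  (`soloInformed_kzpMixedUpTo_one_two_of_ayoubKZeffQ`): granted Ayoub's effective relative period
  conjecture, any two such representations with the same value are Kontsevich–Zagier equivalent.

References: Kontsevich–Zagier, *Periods* (2001), §1.1–§1.2; Ayoub (2015), §2.2.
-/

noncomputable section

open Literature.NumberTheory.Transcendental Literature.NumberTheory.Transcendental.KZ

namespace Summit.KontsevichZagierPeriods.KontsevichZagierPeriods.Theorems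

/-- **PRES(1).**  Every absolutely convergent one-dimensional integral representation (algebraic
integrand, semialgebraic domain) is presentable. [this work] -/
theorem soloInformed_presAll_one : SoloInformedPresAll 1 :=
  soloInformed_presAll_of_presRat_succ soloInformed_presRat_two

/-- **CUBE(1).**  Every integral representation on the unit interval is presentable. [this work] -/
theorem soloInformed_cubeDim_one : SoloInformedCubeDim 1 :=
  soloInformed_cubeDim_of_presAll soloInformed_presAll_one

/-- A representation is *in the proved range* of the ladder if it is one-dimensional (any
integrand) or rational of dimension at most two. [this work] -/
def SoloInformedInProvedRange {n : ℕ} (r : IntegralRep n) : Prop :=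
  n ≤ 1 ∨ (n ≤ 2 ∧ r.IsRational)

/-- Representations in the proved range are presentable. [this work] -/
theorem soloInformed_presentable_of_inProvedRange {n : ℕ} (r : IntegralRep n)
    (hr : SoloInformedInProvedRange r) : of r ∈ soloInformedPresentable := by
  rcases hr with hn | ⟨hn, hrat⟩
  · interval_cases n
    · exact soloInformed_presAll_zero r
    · exact soloInformed_presAll_one r
  · exact soloInformed_presRat_of_le hn soloInformed_presRat_two r hrat

/-- **KZP in the proved range, from Ayoub's effective conjecture.**  Granted `KZ_eff(ℚ)`, two
absolutely convergent integral representations with the same value, each either of dimension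
`≤ 1` (arbitrary algebraic integrand) or rational of dimension `≤ 2`, are equivalent under the
Kontsevich–Zagier rules. [this work] -/
theorem soloInformed_kzpMixedUpTo_one_two_of_ayoubKZeffQ (hA : SoloInformedAyoubKZeffQ)
    {n n' : ℕ} (r : IntegralRep n) (r' : IntegralRep n') (hr : SoloInformedInProvedRange r)
    (hr' : SoloInformedInProvedRange r') (hv : r.value = r'.value) : Equivalent r r' :=
  soloInformed_equivalent_of_presentable hA (soloInformed_presentable_of_inProvedRange r hr)
    (soloInformed_presentable_of_inProvedRange r' hr') hv

end Summit.KontsevichZagierPeriods.KontsevichZagierPeriods.Theorems
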